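import Summits.RiemannHypothesis.RiemannHypothesis.Theorems.TiltedLandingLaw421R3TouchedGlueH

/-!
# Glue v5, part 5 — FRAME-ADAPTIVE β RESERVATION (lens-2 g7, module 41e; answers director-rh (CA738) «41e converter variant» + crit-1 g6 CUT 40)

ONE import: part 3 `…R3TouchedGlueH` (#1205).  SUPPORT + GLUE only: no new law, no registry move; Γ4's binder `hrest` is UNCHANGED in type.

THE WASTE CUT 40 FOUND.  On crit-1's sparse full-height family F* (a lowest pair `v = i·Hs(1−δ)` plus ONE same-height non-touching companion
inside the near window, sea-less) the approach allowance `approachBudgetHalfQ riseSupQ consSupQ F*` tends to `(11/16)·P` (`P = (Hs/s)²`), but the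
rev-7.1 fit `hfit` of `approachC_of_TH` RESERVES the β purse `betaPurseWQ cF L F* + aT F*` (`≈ 0.445·P` at T★) on EVERY legal frame — also on F*,
which has NO charged β-level at all — leaving `aRest F* ≤ 0.2425·P` for an approach tail that costs `→ P/4`: the ×1.03 knife-edge of CUT 40 (1).
The knife-edge is a RESERVATION ARTEFACT of the fit, not a property of the laws: the β class law proved in part 3 (`betaClassLaw_of_TH`) bounds the
β net cost by the purse, and on a frame WITHOUT a charged β-level that net cost is `0`, so nothing need be reserved there.

WHAT IT TYPES (all (K), 0 sorries).
  §A1 `betaUsedQ κ₀ aβ` — the FRAME-ADAPTIVE β allowance: `aβ F` if the frame has a charged β-level (`∃ k, Charged k ∧ BetaLevelQ κ₀ F k`), else `0`;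
      its two case lemmas and `betaUsedQ_le` (it never exceeds a non-negative `aβ`).
  §A2 `classLawQ_betaUsed` — ANY β class law `ClassLawQ (BetaLevelQ κ₀) aβ` sharpens for free to `ClassLawQ (BetaLevelQ κ₀) (betaUsedQ κ₀ aβ)`
      (on a frame with no charged β-level the class net cost `netCostQ (BetaLevelQ κ₀) (k+1)` is a sum of zeros).
  §A3 `approachC_of_TH_adaptive` / `…_adaptive_canonical` — the rev-7.1 converter with the fit RELAXED to
      FIT″ : `betaUsedQ κ₀ (betaPurseWQ cF L + aT) F + aRest F ≤ approachBudgetHalfQ aR aC F` per legal frame; the canonical instance concludes the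
      registry's literal `ApproachAllowanceQ (approachBudgetHalfQ riseSupQ consSupQ)`.  `fitW_implies_fitAdaptive`: FIT_W ⟹ FIT″ whenever the
      reserved amount is non-negative on legal frames, so 41e is never weaker than #1205's converter.
READING.  On F* (no charged β-level) FIT″ reads `aRest F* ≤ (11/16 − …)·P`, i.e. Γ4-as-COUNT has margin `(11/16)/(1/4) = ×2.75` there instead of
×0.97; on frames WITH a charged β-level FIT″ = FIT_W verbatim (CUT 38 / E8′ / CUT 39 benches unchanged).  What 41e does NOT do: it does not re-home
the LOOSE approach levels (far-type dissipation `X″ ≥ 4/5`) to the far energy potential — that is the rev-8 CLASS RE-CUT (crit-1 CUT 40 (3),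
director (CA738)), a registry-level decision, because inside ★A's fixed type a loose-level energy law would debit the far purse a second time.
Numbers (c, L, κ₀, θ, aT, aRest) stay PARAMETERS; nothing here is an instance.

Nothing here bears on the truth of RH; RH is not proved; T⁗ / Γ3″ / Γ4 / FIT″ are typed OPEN hypotheses; ★A / 33346 / 33347 OPEN;
checked ≠ landed ≠ proved.
-/

namespace RhW08.TouchedGlueHAdapt

open RhW08.Round1 RhW08.StSwap RhW08.Round2 RhW08.QuadW
open RhW08.SealSwap (PBot)
open RhW08.SealSwapQ RhW08.RateSplit RhW08.BurgersRate RhW08.BurgersRateG3 RhW08.TouchedDissipation RhW08.TouchedDissipationW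
open RhIdea6.G17.W07C7 RhIdea6.G17.W07C7.Rev6 RhIdea6.G18.W07C8.Law421BirthS RhIdea6.G19.W07C11.Seam
open RhIdea6.G20.W07C12.Frac RhIdea6.G20.W07C12.StColP RhW07.C12.FieldSplit RhIdea6.G21.W07C13.TentMax
open RhW07.C14.TwoSided RhW07.C14.Classes RhW07.C14.Lineage RhW07.C14.Booking
open RhW08.TouchedGlueW RhW08.TouchedGlueH

/-! ## §A1 the frame-adaptive β allowance -/

/-- §A1 a frame HAS A CHARGED β-LEVEL: some level `k` is charged and lies in the paid β class `BetaLevelQ κ₀`. -/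
def HasBetaLevelQ (κ₀ η : ℝ) (f : ℂ → ℂ) (x₀ s hmax R Hs : ℝ) (B : ℕ) : Prop :=
  ∃ k : ℕ, Charged (PTrkSQ PBot) StTrkDQ ReadyR2 η f x₀ s hmax R Hs B k ∧ BetaLevelQ κ₀ η f x₀ s hmax R Hs B k

/-- §A1 the FRAME-ADAPTIVE β allowance: the full allowance `aβ F` on a frame with a charged β-level, `0` on a frame without one. -/
noncomputable def betaUsedQ (κ₀ : ℝ) (aβ : Budget) : Budget := fun η f x₀ s hmax R Hs B =>
  @ite ℝ (HasBetaLevelQ κ₀ η f x₀ s hmax R Hs B) (Classical.propDecidable _) (aβ η f x₀ s hmax R Hs B) 0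

/-- (K) §A1 on a frame WITH a charged β-level the adaptive allowance is the full one. -/
theorem betaUsedQ_of_has {κ₀ : ℝ} {aβ : Budget} {η : ℝ} {f : ℂ → ℂ} {x₀ s hmax R Hs : ℝ} {B : ℕ}
    (h : HasBetaLevelQ κ₀ η f x₀ s hmax R Hs B) : betaUsedQ κ₀ aβ η f x₀ s hmax R Hs B = aβ η f x₀ s hmax R Hs B := by
  unfold betaUsedQ
  exact if_pos h

/-- (K) §A1 on a frame WITHOUT a charged β-level the adaptive allowance is `0`. -/
theorem betaUsedQ_of_not {κ₀ : ℝ} {aβ : Budget} {η : ℝ} {f : ℂ → ℂ} {x₀ s hmax R Hs : ℝ} {B : ℕ}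
    (h : ¬ HasBetaLevelQ κ₀ η f x₀ s hmax R Hs B) : betaUsedQ κ₀ aβ η f x₀ s hmax R Hs B = 0 := by
  unfold betaUsedQ
  exact if_neg h

/-- (K) §A1 the adaptive allowance never exceeds a non-negative full allowance. -/
theorem betaUsedQ_le {κ₀ : ℝ} {aβ : Budget} {η : ℝ} {f : ℂ → ℂ} {x₀ s hmax R Hs : ℝ} {B : ℕ}
    (h0 : 0 ≤ aβ η f x₀ s hmax R Hs B) : betaUsedQ κ₀ aβ η f x₀ s hmax R Hs B ≤ aβ η f x₀ s hmax R Hs B := by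
  by_cases h : HasBetaLevelQ κ₀ η f x₀ s hmax R Hs B
  · rw [betaUsedQ_of_has h]
  · rw [betaUsedQ_of_not h]
    exact h0

/-! ## §A2 any β class law sharpens to the adaptive allowance -/

/-- (K) §A2 on a frame without a charged β-level the β class net cost vanishes at every prefix. -/
theorem netCostQ_beta_eq_zero_of_not {κ₀ η : ℝ} {f : ℂ → ℂ} {x₀ s hmax R Hs : ℝ} {B : ℕ}
    (h : ¬ HasBetaLevelQ κ₀ η f x₀ s hmax R Hs B) (k : ℕ) : netCostQ (BetaLevelQ κ₀) η f x₀ s hmax R Hs B k = 0 := by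
  unfold netCostQ
  refine Finset.sum_eq_zero ?_
  intro j _
  rw [if_neg]
  intro hj
  exact h ⟨j, hj⟩

/-- ★ (K) §A2 **ADAPTIVE SHARPENING**: a β class law with allowance `aβ` holds with the frame-adaptive allowance `betaUsedQ κ₀ aβ`. -/
theorem classLawQ_betaUsed {κ₀ : ℝ} {aβ : Budget} (hβ : ClassLawQ (BetaLevelQ κ₀) aβ) :
    ClassLawQ (BetaLevelQ κ₀) (betaUsedQ κ₀ aβ) := by
  intro η f x₀ s hmax R Hs B hE k hk
  by_cases h : HasBetaLevelQ κ₀ η f x₀ s hmax R Hs B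
  · rw [betaUsedQ_of_has h]
    exact hβ η f x₀ s hmax R Hs B hE k hk
  · rw [betaUsedQ_of_not h, netCostQ_beta_eq_zero_of_not h]

/-! ## §A3 the converter with the frame-adaptive fit -/

/-- ★★ (K, modulo the NAMED hypotheses) **THE GLUE v5 / rev 7.2 (frame-adaptive fit)**: W(cF) with `cF > 0` on legal frames + (Γ3″) rise allowance +
(Γ4) the rest of the approach class + FIT″ (the β purse and `aT` reserved ONLY on frames with a charged β-level) ⟹ `ApproachAllowanceQ
(approachBudgetHalfQ aR aC)` for ANY budgets `aR aC`. -/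
theorem approachC_of_TH_adaptive {cF : Budget} {L κ₀ : ℝ} {aT aRest aR aC : Budget}
    (hcF : ∀ (η : ℝ) (f : ℂ → ℂ) (x₀ s hmax R Hs : ℝ) (B : ℕ), EngineHyps5 2 η f x₀ s hmax R Hs B → 0 < cF η f x₀ s hmax R Hs B)
    (hL : 0 ≤ L) (hT : TouchedDissipationLawWQ cF L κ₀) (hrise : TouchRiseLawHQ cF L κ₀ aT)
    (hrest : ClassLawQ (diffClass ApproachLevelQ (BetaLevelQ κ₀)) aRest)
    (hfit : ∀ (η : ℝ) (f : ℂ → ℂ) (x₀ s hmax R Hs : ℝ) (B : ℕ), EngineHyps5 2 η f x₀ s hmax R Hs B →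
      betaUsedQ κ₀ (addBudget (betaPurseWQ cF L) aT) η f x₀ s hmax R Hs B + aRest η f x₀ s hmax R Hs B
        ≤ approachBudgetHalfQ aR aC η f x₀ s hmax R Hs B) :
    ApproachAllowanceQ (approachBudgetHalfQ aR aC) :=
  classLawQ_mono (approachAllowanceQ_of_beta_rest (classLawQ_betaUsed (betaClassLaw_of_TH hcF hL hT hrise)) hrest)
    (fun η f x₀ s hmax R Hs B hE => by
      show betaUsedQ κ₀ (addBudget (betaPurseWQ cF L) aT) η f x₀ s hmax R Hs B + aRest η f x₀ s hmax R Hs B ≤ _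
      exact hfit η f x₀ s hmax R Hs B hE)

/-- ★★ (K) the CANONICAL instance of the adaptive converter — literally the registry's `stub_approachC` conclusion
`ApproachAllowanceQ (approachBudgetHalfQ riseSupQ consSupQ)`. -/
theorem approachC_of_TH_adaptive_canonical {cF : Budget} {L κ₀ : ℝ} {aT aRest : Budget}
    (hcF : ∀ (η : ℝ) (f : ℂ → ℂ) (x₀ s hmax R Hs : ℝ) (B : ℕ), EngineHyps5 2 η f x₀ s hmax R Hs B → 0 < cF η f x₀ s hmax R Hs B)
    (hL : 0 ≤ L) (hT : TouchedDissipationLawWQ cF L κ₀) (hrise : TouchRiseLawHQ cF L κ₀ aT)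
    (hrest : ClassLawQ (diffClass ApproachLevelQ (BetaLevelQ κ₀)) aRest)
    (hfit : ∀ (η : ℝ) (f : ℂ → ℂ) (x₀ s hmax R Hs : ℝ) (B : ℕ), EngineHyps5 2 η f x₀ s hmax R Hs B →
      betaUsedQ κ₀ (addBudget (betaPurseWQ cF L) aT) η f x₀ s hmax R Hs B + aRest η f x₀ s hmax R Hs B
        ≤ approachBudgetHalfQ riseSupQ consSupQ η f x₀ s hmax R Hs B) :
    ApproachAllowanceQ (approachBudgetHalfQ riseSupQ consSupQ) :=
  approachC_of_TH_adaptive hcF hL hT hrise hrest hfit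

/-- (K) §A3 FIT_W ⟹ FIT″ whenever the reserved amount `betaPurseWQ cF L F + aT F` is non-negative on legal frames: the adaptive converter is never
weaker than #1205's `approachC_of_TH`. -/
theorem fitW_implies_fitAdaptive {cF : Budget} {L κ₀ : ℝ} {aT aRest aA : Budget}
    (h0 : ∀ (η : ℝ) (f : ℂ → ℂ) (x₀ s hmax R Hs : ℝ) (B : ℕ), EngineHyps5 2 η f x₀ s hmax R Hs B →
      0 ≤ betaPurseWQ cF L η f x₀ s hmax R Hs B + aT η f x₀ s hmax R Hs B)
    (hfit : ∀ (η : ℝ) (f : ℂ → ℂ) (x₀ s hmax R Hs : ℝ) (B : ℕ), EngineHyps5 2 η f x₀ s hmax R Hs B →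
      betaPurseWQ cF L η f x₀ s hmax R Hs B + aT η f x₀ s hmax R Hs B + aRest η f x₀ s hmax R Hs B ≤ aA η f x₀ s hmax R Hs B) :
    ∀ (η : ℝ) (f : ℂ → ℂ) (x₀ s hmax R Hs : ℝ) (B : ℕ), EngineHyps5 2 η f x₀ s hmax R Hs B →
      betaUsedQ κ₀ (addBudget (betaPurseWQ cF L) aT) η f x₀ s hmax R Hs B + aRest η f x₀ s hmax R Hs B ≤ aA η f x₀ s hmax R Hs B := by
  intro η f x₀ s hmax R Hs B hE
  have hle : betaUsedQ κ₀ (addBudget (betaPurseWQ cF L) aT) η f x₀ s hmax R Hs B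
      ≤ betaPurseWQ cF L η f x₀ s hmax R Hs B + aT η f x₀ s hmax R Hs B :=
    betaUsedQ_le (aβ := addBudget (betaPurseWQ cF L) aT) (h0 η f x₀ s hmax R Hs B hE)
  linarith [hfit η f x₀ s hmax R Hs B hE]

/-- (K) §A3 READING ON A FRAME WITHOUT A CHARGED β-LEVEL (crit-1's F*): FIT″ there is just `aRest F ≤ allowance F` — no β purse, no `aT` reserved. -/
theorem fitAdaptive_of_not {cF : Budget} {L κ₀ : ℝ} {aT aRest aA : Budget} {η : ℝ} {f : ℂ → ℂ} {x₀ s hmax R Hs : ℝ} {B : ℕ}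
    (h : ¬ HasBetaLevelQ κ₀ η f x₀ s hmax R Hs B) (hrest : aRest η f x₀ s hmax R Hs B ≤ aA η f x₀ s hmax R Hs B) :
    betaUsedQ κ₀ (addBudget (betaPurseWQ cF L) aT) η f x₀ s hmax R Hs B + aRest η f x₀ s hmax R Hs B ≤ aA η f x₀ s hmax R Hs B := by
  rw [betaUsedQ_of_not h, zero_add]
  exact hrest

end RhW08.TouchedGlueHAdapt
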